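import Literature.AnabelianGeometry.EtaleTheta.KummerContainerZHatTwist
import Literature.AnabelianGeometry.EtaleTheta.KummerMapExactness
import Literature.AnabelianGeometry.EtaleTheta.ZHatLevelDetermination
import Literature.AnabelianGeometry.EtaleTheta.KummerContainerZHatTwistGalois
import Mathlib.FieldTheory.Galois.Infinite
import Mathlib.RingTheory.Norm.Basic
import Mathlib.RingTheory.DedekindDomain.SelmerGroup
import Mathlib.NumberTheory.NumberField.Basic
import HarnessLib

/-!
# Twisted Kummer classes of elements of `k` versus `ℤ`-valued characters (valuations): the VALUATION-TRANSPORT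
# law of [IUTchI] Ex. 5.1 (v) at the GENUINE arithmetic Kummer container `Γ_k ↷ k̄ˣ`

Sources. LANA Project interim report [LANA2026Report], §6.1 "Generalities on Kummer maps", pp. 31–32 (the Kummer map
`κ : M → lim_{→ H} H¹(H, Λ(M))` over open subgroups `H`; the tree's `kummerMap` into `H1Colimit` with its `Ẑ^× = Aut(Ẑ)`
-module structure `H1ColimTwist`, abc-iut-w4-d056 `KummerContainerZHatTwist.lean`). S. Mochizuki, *Inter-universal
Teichmüller theory I*, kurims manuscript (May 2020), Ex. 5.1 (v) p. 128 l. 25–49 [claim: Mochizuki2012, status: disputed]: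
the unique isomorphism of cyclotomes `μ^Θ_Ẑ(π₁(†𝒟^⊚)) ⥲ μ_Ẑ(†𝕄^⊛)` is the one "compatible with the integral submonoids
`𝒪^⊿_𝔭`"; (iv) p. 126 l. 35–38: `𝒪^⊿_𝔭 ⊆ 𝒪^×(A^birat) = F_mod^×` is "the submonoid of integral elements … with respect to
the valuation determined by `𝔭`". Classical background: Krull topology / Galois correspondence for `k̄/k`; norms.

Cell abc-iut, GAP-LEDGER row **G-w4d057g4-1** = law (V) "valuation transport" of
`Literature.IUT.HodgeTheaters.UniqueCyclotomeIsoFamily.of_integral_laws` (p427568) at the genuine `†𝕄^⊛` Kummer data: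
"`u · κ(x) = κ(y)`, `x, y ∈ F_mod^×` ⟹ `u · v_𝔭(x) = v_𝔭(y)` in `Ẑ`". PROOF-ONLY (no definition, no named fact).

* §1 (any `G ↷ A` rootable, any directed exhaustive `S`): if the twist by `u ∈ Aut(Ẑ)` of the Kummer class of `x` is
  the Kummer class of `y` at a level `H`, then `x ^ χ_n(u) · y⁻¹` is an `n`-th power IN `A^H` for every `n` (the
  cocycles differ by the coboundary of some `ζ ∈ Λ(A)`; read component `n`); from `u · κ(x) = κ(y)` in the direct
  limit the same holds at ONE level for all `n` (exactness of Mathlib's `DirectLimit`).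
* §2 (`Ẑ`): `(∀ n, n ∣ d · (χ_n(u) · a − b)) ⟹ u(η a) = η b` (`d ≥ 1` fixed); `η` is injective.
* §3 (`k` of characteristic `0`, `Γ_k ↷ (AlgebraicClosure k)ˣ`, each `S i ⊇ Gal(k̄/L_i)` with `L_i/k` FINITE — e.g.
  open subgroups): **`apply_eta_eq_eta_of_H1ColimTwist_kummerMap_eq`** — `u · κ(x) = κ(y)`, `x, y ∈ kˣ` ⟹
  `u(η(φ x)) = η(φ y)` for EVERY homomorphism `φ : kˣ → ℤ` (invariants at the level lie in `L` by the Galois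
  correspondence; the NORM `N_{L/k}` turns `x ^ χ_n(u) / y = w_n ^ n`, `w_n ∈ L`, into `n ∣ [L:k]·(χ_n(u)·φ x − φ y)`);
  `character_eq_of_kummerMap_eq` (`u = 1`: Kummer classes DETERMINE characters, so valuation readings of the layer
  `κ(kˣ)` are well defined without injectivity of `κ`; `exists_reading_of_character`); **`valuationTransport_law`** —
  (V) in the verbatim shape of `of_integral_laws` (`im₂ i₀ := κ(kˣ)`, `twist := H1ColimTwist`); `…_of_isOpen`.
* §4 (`k` a number field): the case `φ = v_𝔭` (Mathlib `HeightOneSpectrum.valuationOfNeZero`), every finite `𝔭`.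

NOT done here: the identification of abc-iut-L5-t12's free `CyclotomeComparisonFamily` with this container (E51
holder), laws (E)/(T) ([AbsTopIII] Thm 1.9 (d)(e); w4-d056's `kummerMap_absoluteGaloisGroup_equivariant_eq_twist`); given
a reading with `val (κ x) = v_𝔭(x)`, laws (I)/(P) are immediate (definition of `𝒪^⊿_𝔭`, a uniformizer).
HONEST FRAMING: classical; OUR kernel check; nothing here bears on [IUTchIII] Cor. 3.12; typed ≠ proved elsewhere.
Universe `Type` (Mathlib `groupCohomology`), as in the Kummer files.
-/

noncomputable section

open CategoryTheory groupCohomology ProfiniteGrp ProfiniteGrp.ProfiniteCompletion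

namespace Literature.AnabelianGeometry.EtaleTheta

/-- Bookkeeping in a commutative group: `c / c₀ = (a / a₀) ^ m / (b / b₀) ⟹ a ^ m b⁻¹ c⁻¹ = a₀ ^ m b₀⁻¹ c₀⁻¹`. [folklore] -/
private theorem pow_mul_inv_mul_inv_eq_of_div_eq {A : Type*} [CommGroup A] (a a₀ b b₀ c c₀ : A) (m : ℕ)
    (e : c / c₀ = (a / a₀) ^ m / (b / b₀)) : a ^ m * b⁻¹ * c⁻¹ = a₀ ^ m * b₀⁻¹ * c₀⁻¹ := by
  rw [div_eq_iff_eq_mul] at e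
  subst e
  apply Additive.ofMul.injective
  simp only [ofMul_mul, ofMul_inv, ofMul_pow, ofMul_div, smul_sub]
  abel

/-! ## §1. A twisted Kummer class equal to a Kummer class yields invariant roots (level `H`, then the colimit) -/

section Level

variable {G : Type} [Group G] {A : Type} [CommGroup A] [MulDistribMulAction G A] (H : Subgroup G)

/-- **Level form.** If the twist by `u ∈ Ẑ^× = Aut(Ẑ)` of the Kummer class of `x ∈ A^H` equals the Kummer class
of `y ∈ A^H` in `H¹(H, Λ(A))`, then for every `n ≥ 1` the element `x ^ χ_n(u) · y⁻¹` has an `n`-th root IN `A^H`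
(`χ_n(u) ∈ ℤ/nℤ` the level-`n` cyclotomic character, read as a natural number).  Proof: the two cocycles differ
by the coboundary of some `ζ ∈ Λ(A)`; at the component `n` this says that `ξ_n ^ χ_n(u) · υ_n⁻¹ · ζ_n⁻¹` is
`H`-invariant, where `ξ`, `υ` are the root systems. [cite: LANA2026Report, §6.1 p.31] -/
theorem exists_mem_fixedPoints_pow_eq_of_H1Twist_kummerClass_eq {x y : A} (ξ : RootSystem x) (υ : RootSystem y)
    (hx : x ∈ MulAction.fixedPoints H A) (hy : y ∈ MulAction.fixedPoints H A)
    (u : MulAut (completion (GrpCat.of (Multiplicative ℤ))))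
    (h : H1Twist (A := A) H u (kummerClassOfRootSystem H ξ hx) = kummerClassOfRootSystem H υ hy) (n : ℕ+) :
    ∃ w : A, w ∈ MulAction.fixedPoints H A ∧
      w ^ (n : ℕ) = x ^ (ZHatLevel.levelChar n u).val * y⁻¹ := by
  have hX : H1Twist (A := A) H u (kummerClassOfRootSystem H ξ hx) =
      H1π _ (mapCocycles₁ (MonoidHom.id H) (cyclotomeRepTwist (A := A) H u) (kummerCocycles₁ H ξ hx)) := by
    rw [kummerClassOfRootSystem]
    exact H1π_comp_map_apply (MonoidHom.id H) (cyclotomeRepTwist (A := A) H u) (kummerCocycles₁ H ξ hx)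
  rw [hX, kummerClassOfRootSystem, H1π_eq_iff] at h
  obtain ⟨ζ, hζ⟩ := isMulCoboundary₁_of_mem_coboundaries₁ _ h
  refine ⟨ξ.root n ^ (ZHatLevel.levelChar n u).val * (υ.root n)⁻¹ * (((ζ : cyclotome A) : ℕ+ → A) n)⁻¹, ?_, ?_⟩
  · intro k
    have e : ((k : G) • ζ) / ζ =
        cyclotome.zhatTwist A u (ξ.kummerCocycle hx k) / υ.kummerCocycle hy k := hζ k
    have en := congrArg (fun z : cyclotome A => ((z : cyclotome A) : ℕ+ → A) n) e
    change ((k : G) • ((ζ : cyclotome A) : ℕ+ → A) n) / ((ζ : cyclotome A) : ℕ+ → A) n =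
      (((k : G) • ξ.root n) / ξ.root n) ^ (ZHatLevel.levelChar n u).val / (((k : G) • υ.root n) / υ.root n) at en
    change (k : G) • (ξ.root n ^ (ZHatLevel.levelChar n u).val * (υ.root n)⁻¹ * (((ζ : cyclotome A) : ℕ+ → A) n)⁻¹) =
      ξ.root n ^ (ZHatLevel.levelChar n u).val * (υ.root n)⁻¹ * (((ζ : cyclotome A) : ℕ+ → A) n)⁻¹
    rw [smul_mul', smul_mul', smul_inv', smul_inv', smul_pow']
    exact pow_mul_inv_mul_inv_eq_of_div_eq _ _ _ _ _ _ _ en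
  · rw [mul_pow, mul_pow, inv_pow, inv_pow, ← pow_mul, mul_comm (ZHatLevel.levelChar n u).val, pow_mul,
      ξ.pow_self, υ.pow_self, cyclotome.pow_eq_one, inv_one, mul_one]

end Level

section Colim

variable {G : Type} [Group G] {A : Type} [CommGroup A] [MulDistribMulAction G A]
  {ι : Type} [Preorder ι] [DecidableEq ι] [IsDirectedOrder ι] (S : ι → Subgroup G)
  (hS : ∀ ⦃i j : ι⦄, i ≤ j → S j ≤ S i) [RootableBy A ℕ]

/-- **Colimit form.** If `u · κ(x) = κ(y)` in the Kummer container `lim_{→ i} H¹(S i, Λ(A))` (`u ∈ Ẑ^×` acting by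
`H1ColimTwist`), then at ONE level `S j` fixing `x` and `y`, for EVERY `n ≥ 1`, the element `x ^ χ_n(u) · y⁻¹` has
an `n`-th root in `A^{S j}` (equality in the direct limit holds at some stage — exactness of the direct limit —
and the level form applies there). [cite: LANA2026Report, §6.1 pp. 31–32] -/
theorem exists_level_forall_pow_eq_of_H1ColimTwist_kummerMap_eq (hc : IsExhausted A S) (x y : A)
    (u : MulAut (completion (GrpCat.of (Multiplicative ℤ))))
    (h : H1ColimTwist S hS u (kummerMap hS hc x) = kummerMap hS hc y) :
    ∃ j : ι, x ∈ invariants (A := A) (S j) ∧ y ∈ invariants (A := A) (S j) ∧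
      ∀ n : ℕ+, ∃ w ∈ invariants (A := A) (S j),
        w ^ (n : ℕ) = x ^ (ZHatLevel.levelChar n u).val * y⁻¹ := by
  haveI := directedSystem_H1System (A := A) S hS
  obtain ⟨i₁, hi₁⟩ := hc x
  obtain ⟨i₂, hi₂⟩ := hc y
  obtain ⟨i, h₁, h₂⟩ := exists_ge_ge i₁ i₂
  have hxi : x ∈ invariants (A := A) (S i) := fun γ => hi₁ ⟨γ, hS h₁ γ.2⟩
  have hyi : y ∈ invariants (A := A) (S i) := fun γ => hi₂ ⟨γ, hS h₂ γ.2⟩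
  rw [kummerMap_eq_of hS hc x i hxi, kummerMap_eq_of hS hc y i hyi, H1ColimTwist_toColimit, ← sub_eq_zero,
    ← map_sub] at h
  obtain ⟨j, hij, hj⟩ := AddCommGroup.DirectLimit.of.zero_exact (f := H1System (A := A) S hS) i _ h
  have hxj : x ∈ invariants (A := A) (S j) := fun γ => hxi ⟨γ, hS hij γ.2⟩
  have hyj : y ∈ invariants (A := A) (S j) := fun γ => hyi ⟨γ, hS hij γ.2⟩
  refine ⟨j, hxj, hyj, fun n => ?_⟩
  have hlevel : H1Twist (A := A) (S j) u (kummerClass (S j) ⟨x, hxj⟩) = kummerClass (S j) ⟨y, hyj⟩ := by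
    rw [map_sub, sub_eq_zero] at hj
    change resH1 (hS hij) (H1Twist (A := A) (S i) u (kummerClass (S i) ⟨x, hxi⟩)) =
      resH1 (hS hij) (kummerClass (S i) ⟨y, hyi⟩) at hj
    rwa [resH1_H1Twist, resH1_kummerClass (hS hij) x hxi hxj, resH1_kummerClass (hS hij) y hyi hyj] at hj
  obtain ⟨w, hw, hwn⟩ := exists_mem_fixedPoints_pow_eq_of_H1Twist_kummerClass_eq (S j)
    (RootSystem.ofRootableBy x) (RootSystem.ofRootableBy y) hxj hyj u hlevel n
  exact ⟨w, hw, hwn⟩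

end Colim

/-! ## §2. `Ẑ`: divisibilities at all levels determine `u (η a) = η b` -/

namespace ZHatLevel

/-- If for a fixed `d ≥ 1` and all `n ≥ 1`, `n ∣ d · (χ_n(u) · a − b)` (`χ_n(u)` read as a natural number), then
`u (η a) = η b` in `Ẑ` (take `n := k · d`, cancel `d`, use `χ_{kd}(u) ≡ χ_k(u) (mod k)`, and conclude by levels).
[cite: RibesZalesskii2010, Thm 2.7.1] -/
theorem apply_eta_eq_eta_of_forall_dvd (u : MulAut (completion (GrpCat.of (Multiplicative ℤ)))) {a b : ℤ}
    {d : ℕ+} (h : ∀ n : ℕ+, ((n : ℕ) : ℤ) ∣ (d : ℤ) * (((levelChar n u).val : ℤ) * a - b)) :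
    u (eta a) = eta b := by
  refine ext_of_level fun k => ?_
  apply Multiplicative.toAdd.injective
  rw [toAdd_level_aut, level_eta, level_eta, toAdd_ofAdd, toAdd_ofAdd]
  haveI : NeZero ((k : ℕ)) := NeZero.of_pos k.pos
  -- the hypothesis at `n = k * d`, with `d` cancelled
  have hk : ((k : ℕ) : ℤ) ∣ ((levelChar (k * d) u).val : ℤ) * a - b := by
    have h' := h (k * d)
    have hcoe : (((k * d : ℕ+) : ℕ) : ℤ) = ((d : ℕ) : ℤ) * ((k : ℕ) : ℤ) := by
      rw [PNat.mul_coe, Nat.cast_mul, mul_comm]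
    rw [hcoe] at h'
    exact Int.dvd_of_mul_dvd_mul_left (by exact_mod_cast d.pos.ne') h'
  -- `χ_{kd}(u)` reduces to `χ_k(u)` modulo `k`
  have hcast : (((levelChar (k * d) u).val : ℤ) : ZMod k) = levelChar k u := by
    have hc := cast_levelChar_mul k d u
    rw [ZMod.castHom_apply] at hc
    rw [Int.cast_natCast, ZMod.natCast_val]
    exact hc
  have h0 := (ZMod.intCast_zmod_eq_zero_iff_dvd _ k).2 hk
  rw [Int.cast_sub, Int.cast_mul, hcast, sub_eq_zero] at h0
  exact h0

/-- `η : ℤ → Ẑ` is injective (an integer divisible by every `n ≥ 1` vanishes). [cite: RibesZalesskii2010, Thm 2.7.1] -/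
theorem eta_injective : Function.Injective eta := by
  intro a b h
  by_contra hne
  have hba : b - a ≠ 0 := sub_ne_zero.2 (Ne.symm hne)
  have h2 := congrArg (fun z => Multiplicative.toAdd (level ⟨(b - a).natAbs + 1, Nat.succ_pos _⟩ z)) h
  simp only [level_eta, toAdd_ofAdd] at h2
  have hdvd := (ZMod.intCast_eq_intCast_iff_dvd_sub a b _).1 h2
  simp only [PNat.mk_coe, Nat.cast_add, Nat.cast_one, Int.natCast_natAbs] at hdvd
  have hle := Int.le_of_dvd (abs_pos.2 hba) ((dvd_abs _ _).2 hdvd)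
  omega

end ZHatLevel

/-! ## §3. The arithmetic container `Γ_k ↷ k̄ˣ`: twisted Kummer classes of elements of `k` and their characters -/

section Arithmetic

open IntermediateField

variable (k : Type) [Field k] [CharZero k] {ι : Type} [Preorder ι] [DecidableEq ι] [IsDirectedOrder ι]
  (S : ι → Subgroup (Field.absoluteGaloisGroup k)) (hS : ∀ ⦃i j : ι⦄, i ≤ j → S j ≤ S i)

/-- If a subgroup `H ≤ Γ_k` contains `Gal(k̄/L)` for an intermediate field `L`, then every `H`-invariant unit of
`k̄` lies in `L` (Galois correspondence for `k̄/k`: `Fix(Gal(k̄/L)) = L`, Mathlib `InfiniteGalois.fixedField_fixingSubgroup`).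
[cite: NeukirchANT1999, Ch. IV §1 Thm. (1.2)] -/
theorem val_mem_of_mem_invariants {H : Subgroup (Field.absoluteGaloisGroup k)}
    (L : IntermediateField k (AlgebraicClosure k))
    (hL : ∀ σ : Field.absoluteGaloisGroup k, Field.absoluteGaloisGroup.toAlgEquiv k σ ∈ L.fixingSubgroup → σ ∈ H)
    {a : (AlgebraicClosure k)ˣ} (ha : a ∈ invariants (A := (AlgebraicClosure k)ˣ) H) :
    (a : AlgebraicClosure k) ∈ L := by
  have hmem : (a : AlgebraicClosure k) ∈ fixedField L.fixingSubgroup := by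
    rw [mem_fixedField_iff]
    intro f hf
    have h1 := ha ⟨(Field.absoluteGaloisGroup.toAlgEquiv k).symm f, hL _ (by simpa using hf)⟩
    exact congrArg Units.val h1
  rwa [InfiniteGalois.fixedField_fixingSubgroup] at hmem

/-- **Twisted Kummer classes of elements of `k` and `ℤ`-valued characters.**  Let `k` be a field of characteristic
`0`, `Γ_k ↷ k̄ˣ` (`k̄ = AlgebraicClosure k`), `S` a directed exhaustive system of subgroups of `Γ_k` each containing
`Gal(k̄/L_i)` for some FINITE extension `L_i/k` inside `k̄` (e.g. open subgroups), `κ` the Kummer map into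
`lim_{→ i} H¹(S i, Λ(k̄ˣ))` and `u ∈ Ẑ^× = Aut(Ẑ)` acting on the container by `H1ColimTwist`.  If
`u · κ(x) = κ(y)` for `x, y ∈ kˣ`, then for EVERY homomorphism `φ : kˣ → ℤ`,
`u(η(φ x)) = η(φ y)` in `Ẑ`.  Proof: at one finite level `L`, `x ^ χ_n(u) / y = w_n ^ n` with `w_n ∈ L` for all
`n` (§1); taking norms `N_{L/k}`, `(x ^ χ_n(u) / y) ^ [L:k] = N(w_n) ^ n` in `kˣ`, so `n ∣ [L:k]·(χ_n(u)·φ x − φ y)`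
for all `n`, whence the claim (§2).  In particular (`φ = ord_𝔭`) this is the VALUATION-TRANSPORT law (V) of
[IUTchI] Ex. 5.1 (v) at the genuine Kummer container (cell GAP row G-w4d057g4-1): "compatible with the integral
submonoids `𝒪^⊿_𝔭`" needs `u · v_𝔭(x) = v_𝔭(y)`. [cite: LANA2026Report, §6.1 pp. 31–32]
[cite: Mochizuki2012, IUTchI Ex. 5.1 (v) p. 128] -/
theorem apply_eta_eq_eta_of_H1ColimTwist_kummerMap_eq (hc : IsExhausted (AlgebraicClosure k)ˣ S)
    (hfin : ∀ i, ∃ L : IntermediateField k (AlgebraicClosure k), FiniteDimensional k L ∧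
      ∀ σ : Field.absoluteGaloisGroup k, Field.absoluteGaloisGroup.toAlgEquiv k σ ∈ L.fixingSubgroup → σ ∈ S i)
    (u : MulAut (completion (GrpCat.of (Multiplicative ℤ)))) (x y : kˣ)
    (h : H1ColimTwist S hS u
        (kummerMap hS hc (Units.map (algebraMap k (AlgebraicClosure k) : k →* AlgebraicClosure k) x)) =
      kummerMap hS hc (Units.map (algebraMap k (AlgebraicClosure k) : k →* AlgebraicClosure k) y))
    (φ : kˣ →* Multiplicative ℤ) :
    u (ZHatLevel.eta (Multiplicative.toAdd (φ x))) = ZHatLevel.eta (Multiplicative.toAdd (φ y)) := by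
  obtain ⟨j, -, -, hroots⟩ := exists_level_forall_pow_eq_of_H1ColimTwist_kummerMap_eq S hS hc _ _ u h
  obtain ⟨L, hLfin, hLS⟩ := hfin j
  haveI := hLfin
  refine ZHatLevel.apply_eta_eq_eta_of_forall_dvd u (d := ⟨Module.finrank k L, Module.finrank_pos⟩) fun n => ?_
  obtain ⟨w, hw, hwn⟩ := hroots n
  -- the root `w` lies in the finite extension `L`
  have hwL : (w : AlgebraicClosure k) ∈ L := val_mem_of_mem_invariants k L hLS hw
  have hwn' : (w : AlgebraicClosure k) ^ (n : ℕ) =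
      algebraMap k (AlgebraicClosure k) ((x ^ (ZHatLevel.levelChar n u).val * y⁻¹ : kˣ) : k) := by
    have hv := congrArg Units.val hwn
    rw [Units.val_pow_eq_pow_val] at hv
    rw [hv]
    simp [Units.coe_map]
  -- abbreviate
  generalize hz : (x ^ (ZHatLevel.levelChar n u).val * y⁻¹ : kˣ) = z at hwn'
  generalize hm : (ZHatLevel.levelChar n u).val = m at hz ⊢
  -- read the equation inside `L` and take norms down to `k`
  have hL : (⟨w, hwL⟩ : L) ^ (n : ℕ) = algebraMap k L (z : k) := by
    apply Subtype.ext
    rw [IntermediateField.coe_pow]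
    exact hwn'
  have hN := congrArg (Algebra.norm k) hL
  rw [map_pow, Algebra.norm_algebraMap] at hN
  -- `N(w)` is a unit of `k`
  have hN0 : Algebra.norm k (⟨w, hwL⟩ : L) ≠ 0 := by
    intro h0
    rw [h0, zero_pow n.pos.ne', eq_comm] at hN
    exact (pow_ne_zero _ z.ne_zero) hN
  have hU : (Units.mk0 _ hN0) ^ (n : ℕ) = z ^ (Module.finrank k L) :=
    Units.ext (by rw [Units.val_pow_eq_pow_val, Units.val_pow_eq_pow_val, Units.val_mk0, hN])
  -- apply the character
  have hφ := congrArg (fun t => Multiplicative.toAdd (φ t)) hU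
  simp only [map_pow, map_mul, map_inv, toAdd_pow, toAdd_mul, toAdd_inv, ← hz, nsmul_eq_mul] at hφ
  refine ⟨Multiplicative.toAdd (φ (Units.mk0 _ hN0)), ?_⟩
  rw [PNat.mk_coe]
  linear_combination -hφ

/-- **`u = 1`: Kummer classes determine `ℤ`-valued characters.**  If `κ(x) = κ(y)` in the container for
`x, y ∈ kˣ`, then `φ x = φ y` for every homomorphism `φ : kˣ → ℤ` — e.g. `v_𝔭(x) = v_𝔭(y)` at every prime: the
valuation of a Kummer class of the layer `κ(kˣ)` is WELL DEFINED (no injectivity of `κ` needed).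
[cite: LANA2026Report, §6.1 pp. 31–32] -/
theorem character_eq_of_kummerMap_eq [Nonempty ι] (hc : IsExhausted (AlgebraicClosure k)ˣ S)
    (hfin : ∀ i, ∃ L : IntermediateField k (AlgebraicClosure k), FiniteDimensional k L ∧
      ∀ σ : Field.absoluteGaloisGroup k, Field.absoluteGaloisGroup.toAlgEquiv k σ ∈ L.fixingSubgroup → σ ∈ S i)
    (x y : kˣ)
    (h : kummerMap hS hc (Units.map (algebraMap k (AlgebraicClosure k) : k →* AlgebraicClosure k) x) =
      kummerMap hS hc (Units.map (algebraMap k (AlgebraicClosure k) : k →* AlgebraicClosure k) y))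
    (φ : kˣ →* Multiplicative ℤ) : φ x = φ y := by
  apply Multiplicative.toAdd.injective
  apply ZHatLevel.eta_injective
  have h1 := apply_eta_eq_eta_of_H1ColimTwist_kummerMap_eq k S hS hc hfin 1 x y
    (by rw [H1ColimTwist_one_apply]; exact h) φ
  rwa [MulAut.one_apply] at h1

/-- **Law (V) of [IUTchI] Ex. 5.1 (v) at the genuine container, verbatim shape** (hypothesis `hval` of
`Literature.IUT.HodgeTheaters.UniqueCyclotomeIsoFamily.of_integral_laws`, p427568, with `im₂ i₀ := κ(kˣ)`,
`twist := H1ColimTwist`): for ANY readings `val 𝔭` of the container agreeing with characters `φ 𝔭 : kˣ → ℤ` on Kummer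
classes (they EXIST, `exists_reading_of_character`), every `u ∈ Ẑ^×` preserving the layer transports them:
`u(η(val 𝔭 h)) = η(val 𝔭 (u · h))`, `h ∈ κ(kˣ)`. [cite: Mochizuki2012, IUTchI Ex. 5.1 (v) p. 128] [claim: Mochizuki2012, status: disputed] -/
theorem valuationTransport_law (hc : IsExhausted (AlgebraicClosure k)ˣ S)
    (hfin : ∀ i, ∃ L : IntermediateField k (AlgebraicClosure k), FiniteDimensional k L ∧
      ∀ σ : Field.absoluteGaloisGroup k, Field.absoluteGaloisGroup.toAlgEquiv k σ ∈ L.fixingSubgroup → σ ∈ S i)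
    {𝔓 : Type*} (φ : 𝔓 → (kˣ →* Multiplicative ℤ)) (val : 𝔓 → H1Colimit (AlgebraicClosure k)ˣ S hS → ℤ)
    (hval : ∀ (𝔭 : 𝔓) (x : kˣ),
      val 𝔭 (kummerMap hS hc (Units.map (algebraMap k (AlgebraicClosure k) : k →* AlgebraicClosure k) x)) =
        Multiplicative.toAdd (φ 𝔭 x))
    (u : MulAut (completion (GrpCat.of (Multiplicative ℤ))))
    (hu : Set.MapsTo (H1ColimTwist S hS u)
      (Set.range fun x : kˣ =>
        kummerMap hS hc (Units.map (algebraMap k (AlgebraicClosure k) : k →* AlgebraicClosure k) x))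
      (Set.range fun x : kˣ =>
        kummerMap hS hc (Units.map (algebraMap k (AlgebraicClosure k) : k →* AlgebraicClosure k) x))) :
    ∀ h ∈ Set.range (fun x : kˣ =>
        kummerMap hS hc (Units.map (algebraMap k (AlgebraicClosure k) : k →* AlgebraicClosure k) x)),
      ∀ 𝔭 : 𝔓, u (ZHatLevel.eta (val 𝔭 h)) = ZHatLevel.eta (val 𝔭 (H1ColimTwist S hS u h)) := by
  rintro _ ⟨x, rfl⟩ 𝔭
  obtain ⟨y, hy⟩ := hu ⟨x, rfl⟩
  rw [← hy, hval, hval]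
  exact apply_eta_eq_eta_of_H1ColimTwist_kummerMap_eq k S hS hc hfin u x y hy.symm (φ 𝔭)

/-- **Readings exist**: every character `φ : kˣ → ℤ` extends to a reading `val` of the container with
`val (κ x) = φ x` on the layer `κ(kˣ)` (well defined by `character_eq_of_kummerMap_eq`; `0` off the layer).
[cite: LANA2026Report, §6.1 pp. 31–32] -/
theorem exists_reading_of_character [Nonempty ι] (hc : IsExhausted (AlgebraicClosure k)ˣ S)
    (hfin : ∀ i, ∃ L : IntermediateField k (AlgebraicClosure k), FiniteDimensional k L ∧
      ∀ σ : Field.absoluteGaloisGroup k, Field.absoluteGaloisGroup.toAlgEquiv k σ ∈ L.fixingSubgroup → σ ∈ S i)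
    (φ : kˣ →* Multiplicative ℤ) :
    ∃ val : H1Colimit (AlgebraicClosure k)ˣ S hS → ℤ, ∀ x : kˣ,
      val (kummerMap hS hc (Units.map (algebraMap k (AlgebraicClosure k) : k →* AlgebraicClosure k) x)) =
        Multiplicative.toAdd (φ x) := by
  classical
  let κι : kˣ → H1Colimit (AlgebraicClosure k)ˣ S hS := fun x =>
    kummerMap hS hc (Units.map (algebraMap k (AlgebraicClosure k) : k →* AlgebraicClosure k) x)
  refine ⟨fun h => if hh : ∃ x, κι x = h then Multiplicative.toAdd (φ (Classical.choose hh)) else 0, fun x => ?_⟩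
  have hex : ∃ x', κι x' = κι x := ⟨x, rfl⟩
  simp only [κι, dif_pos hex]
  exact congrArg Multiplicative.toAdd
    (character_eq_of_kummerMap_eq k S hS hc hfin _ _ (Classical.choose_spec hex) φ)

omit [CharZero k] in
/-- **Open systems qualify**: if every `S i` is OPEN in the Krull topology of `Γ_k`, it contains `Gal(k̄/L_i)`
for a finite extension `L_i/k` (the subgroups `Gal(k̄/L)`, `L/k` finite, form a neighbourhood basis of `1` in the
Krull topology). [cite: NeukirchANT1999, Ch. IV §1] -/
theorem exists_finite_fixingSubgroup_le_of_isOpen (H : Subgroup (Field.absoluteGaloisGroup k))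
    (hH : IsOpen (H : Set (Field.absoluteGaloisGroup k))) :
    ∃ L : IntermediateField k (AlgebraicClosure k), FiniteDimensional k L ∧
      ∀ σ : Field.absoluteGaloisGroup k, Field.absoluteGaloisGroup.toAlgEquiv k σ ∈ L.fixingSubgroup → σ ∈ H := by
  have h1 : (H : Set (Field.absoluteGaloisGroup k)) ∈ nhds (1 : Field.absoluteGaloisGroup k) :=
    hH.mem_nhds H.one_mem
  have h1' : ((H : Set (Field.absoluteGaloisGroup k)) : Set (AlgebraicClosure k ≃ₐ[k] AlgebraicClosure k)) ∈
      nhds (1 : AlgebraicClosure k ≃ₐ[k] AlgebraicClosure k) := h1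
  obtain ⟨L, hL, hsub⟩ := (krullTopology_mem_nhds_one_iff k (AlgebraicClosure k) _).1 h1'
  exact ⟨L, hL, fun σ hσ => hsub hσ⟩

/-- **Open systems**: the transport theorem for a directed exhaustive system of OPEN subgroups of `Γ_k` (print:
"`H` ranges over the open subgroups", `lim_H H¹(H, μ_Ẑ(†𝕄^⊛))`). [cite: LANA2026Report, §6.1 pp. 31–32]
[cite: Mochizuki2012, IUTchI Ex. 5.1 (v) p. 128] -/
theorem apply_eta_eq_eta_of_H1ColimTwist_kummerMap_eq_of_isOpen (hc : IsExhausted (AlgebraicClosure k)ˣ S)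
    (hopen : ∀ i, IsOpen (S i : Set (Field.absoluteGaloisGroup k)))
    (u : MulAut (completion (GrpCat.of (Multiplicative ℤ)))) (x y : kˣ)
    (h : H1ColimTwist S hS u
        (kummerMap hS hc (Units.map (algebraMap k (AlgebraicClosure k) : k →* AlgebraicClosure k) x)) =
      kummerMap hS hc (Units.map (algebraMap k (AlgebraicClosure k) : k →* AlgebraicClosure k) y))
    (φ : kˣ →* Multiplicative ℤ) :
    u (ZHatLevel.eta (Multiplicative.toAdd (φ x))) = ZHatLevel.eta (Multiplicative.toAdd (φ y)) :=
  apply_eta_eq_eta_of_H1ColimTwist_kummerMap_eq k S hS hc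
    (fun i => exists_finite_fixingSubgroup_le_of_isOpen k (S i) (hopen i)) u x y h φ

end Arithmetic

section NumberField

open NumberField IsDedekindDomain

variable (k : Type) [Field k] [NumberField k] {ι : Type} [Preorder ι] [DecidableEq ι] [IsDirectedOrder ι]
  (S : ι → Subgroup (Field.absoluteGaloisGroup k)) (hS : ∀ ⦃i j : ι⦄, i ≤ j → S j ≤ S i)

/-- **Law (V) for the valuations of a number field** ([IUTchI] Ex. 5.1 (v), p. 128: "compatible with the integral
submonoids `𝒪^⊿_𝔭`" at the genuine Kummer container of `F_mod`): if `u · κ(x) = κ(y)` for `x, y ∈ kˣ`, `k` a number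
field, then `u(η(v_𝔭 x)) = η(v_𝔭 y)` for every finite prime `𝔭` of `k` (`v_𝔭` = Mathlib's `valuationOfNeZero`,
any sign normalisation being covered by `apply_eta_eq_eta_of_H1ColimTwist_kummerMap_eq` for arbitrary characters).
[cite: Mochizuki2012, IUTchI Ex. 5.1 (v) p. 128] [claim: Mochizuki2012, status: disputed]
[cite: LANA2026Report, §6.1 pp. 31–32] -/
theorem apply_eta_valuation_eq_of_H1ColimTwist_kummerMap_eq (hc : IsExhausted (AlgebraicClosure k)ˣ S)
    (hfin : ∀ i, ∃ L : IntermediateField k (AlgebraicClosure k), FiniteDimensional k L ∧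
      ∀ σ : Field.absoluteGaloisGroup k, Field.absoluteGaloisGroup.toAlgEquiv k σ ∈ L.fixingSubgroup → σ ∈ S i)
    (u : MulAut (completion (GrpCat.of (Multiplicative ℤ)))) (x y : kˣ)
    (h : H1ColimTwist S hS u
        (kummerMap hS hc (Units.map (algebraMap k (AlgebraicClosure k) : k →* AlgebraicClosure k) x)) =
      kummerMap hS hc (Units.map (algebraMap k (AlgebraicClosure k) : k →* AlgebraicClosure k) y))
    (𝔭 : HeightOneSpectrum (𝓞 k)) :
    u (ZHatLevel.eta (Multiplicative.toAdd (𝔭.valuationOfNeZero (K := k) x))) =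
      ZHatLevel.eta (Multiplicative.toAdd (𝔭.valuationOfNeZero (K := k) y)) :=
  apply_eta_eq_eta_of_H1ColimTwist_kummerMap_eq k S hS hc hfin u x y h (𝔭.valuationOfNeZero (K := k))

/-- **Kummer classes determine valuations** (number field case, `u = 1`). [cite: LANA2026Report, §6.1 pp. 31–32] -/
theorem valuation_eq_of_kummerMap_eq [Nonempty ι] (hc : IsExhausted (AlgebraicClosure k)ˣ S)
    (hfin : ∀ i, ∃ L : IntermediateField k (AlgebraicClosure k), FiniteDimensional k L ∧
      ∀ σ : Field.absoluteGaloisGroup k, Field.absoluteGaloisGroup.toAlgEquiv k σ ∈ L.fixingSubgroup → σ ∈ S i)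
    (x y : kˣ)
    (h : kummerMap hS hc (Units.map (algebraMap k (AlgebraicClosure k) : k →* AlgebraicClosure k) x) =
      kummerMap hS hc (Units.map (algebraMap k (AlgebraicClosure k) : k →* AlgebraicClosure k) y))
    (𝔭 : HeightOneSpectrum (𝓞 k)) :
    𝔭.valuationOfNeZero (K := k) x = 𝔭.valuationOfNeZero (K := k) y :=
  character_eq_of_kummerMap_eq k S hS hc hfin x y h _

end NumberField

end Literature.AnabelianGeometry.EtaleTheta

end
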